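import Summits.BirchSwinnertonDyer.BirchSwinnertonDyer.Theorems.PrintCf2SplitBadTwoRestrictedSelmerCokernelOfLocSurjFinite
import Summits.BirchSwinnertonDyer.BirchSwinnertonDyer.Theorems.PrintCf2SplitBadTwoRestrictedSelmerBaseLiftOfLocSurj
import HarnessLib

/-!
# Crux `PrintCf2.SplitBadTwoRankOneOfFacts` (stmt-BirchSwinnertonDyer-20368), road α v10.3 — S3c residual (R-TOP′) of cut 8 (class-function form)
# FROM THE SAME DISPLAYED STATEMENT «bottom finiteness → (LS)» as (R-SURJ″), plus the conjugation transport (CT-𝔖) and the two cited facts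

Cell `bsd-print-cf2`, width seat `bsd-line-cf2-p1-w5` g3 (prover-bsd-line-cf2-p1-w5-g3-0). `--supports stmt-BirchSwinnertonDyer-20368` (helper, Theses-free).
HONEST FRAMING: nothing here closes the crux or a registered stub; BSD is not proved by any of this; no summit statement is proved by this seat. No
definition, no named fact, no `sorry`. CONDITIONAL on the displayed hypotheses `hLSfin` ((LS) under bottom finiteness — -w4 g9's port, p668156 /
p670877 / `levelLiftingP_of_proj`), `hTr` ((CT-𝔖) — -w2 g10's conjugation transport `Finite 𝔖_{v̄}(K, W*) → Finite 𝔖_v(K, W*′)`), and on the cited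
facts `poitouTate_sha_tateDual`, `fieldCdLE_two_of_numberField` (through -w4 g9's p667090/p668156).

WHAT. LEAD g12's cut 8 (`restrictedControl_two_of_three_residuals`, p670076) displays (R-TOP′) (`hTop`: `v₂ #𝔖_Γ` a class function), (C3-ψ) (now a
theorem, -w6 g3), (R-SURJ″) (`hSurj`) and (R-BV). Both (R-TOP′) and (R-SURJ″) follow from the level-`K` local surjectivity (LS) (LEAD ruling
21:04:53Z); this file packages that:
* **`rTop'_of_locSurj_of_finite`** — (R-TOP′) with `eΓ ≡ 0`, in the text of cut 8's `hTop` WITH ONE EXTRA INSTANCE BINDER `[W.IsGloballyMinimal]` after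
  `[W.IsElliptic]` (required by -w4 g9's `natCard_endCoinvariants_eq_one_of_frame_of_locSurj`; S3c's own binder list has it, so cut 9 can display
  `hTop` in this form and instantiate it at the conclusion's `W`), from `hPT`, `hcd`, `hTr`, `hLSfin`: per frame the dual datum `D` with
  `HasCharValuationAt n` gives `𝔖_{v̄}(K, W*)` finite (`hasCharValuationAt_control_identity_endEigenPrimaryTorsion`), (CT-𝔖) gives the conjugate
  finiteness hfinB′, `hLSfin` gives (LS), and -w4 g9's theorem gives `#𝔖_Γ = 1`;
* with file 4c's `rSurj''_of_locSurj_of_finite` (p671382; SAME `hLSfin`) cut 9 reads: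
  `restrictedControl_two_of_three_residuals' (rTop'_of_locSurj_of_finite hPT hcd hTr hLSfin) hψ (rSurj''_of_locSurj_of_finite hLSfin) hBV`
  up to the `[W.IsGloballyMinimal]` binder of `hTop`.
presearch: not applicable (assembly). beyond-print theorem: no.

References: [Agboola2007] §3 Prop. 3.2, §5 Prop. 5.1, §6; [GreenbergLNM1716] §3 Lemmas 3.1–3.3, §4 Props. 4.13–4.15; [JetchevSkinnerWan2017]
Lemma 3.3.3, Prop. 3.3.2.
-/

noncomputable section

open scoped Classical

set_option linter.dupNamespace false
set_option autoImplicit false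

open NumberField IsDedekindDomain Field WeierstrassCurve
open Literature.NumberTheory.EllipticCurves Literature.NumberTheory.EllipticCurves.GreenbergSelmer
open Literature.NumberTheory.EllipticCurves.Agboola2007
open Literature.NumberTheory.EllipticCurves.IwasawaAlgebra
open Literature.NumberTheory.EllipticCurves.IwasawaDual
open Literature.NumberTheory.EllipticCurves.ResKernel
open Literature.NumberTheory.GaloisRepresentations
open Literature.NumberTheory.GaloisCohomology
open Summit.BirchSwinnertonDyer.BirchSwinnertonDyer.Theorems.PrintCf2.AdditiveAtSeven
open Summit.BirchSwinnertonDyer.BirchSwinnertonDyer.Theorems.GoldfeldGoodTwists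

namespace Summit.BirchSwinnertonDyer.BirchSwinnertonDyer.Theorems.PrintCf2.RestrictedSelmerPair

/-- **(R-TOP′) OF CUT 8 (with the extra binder `[W.IsGloballyMinimal]`), `eΓ ≡ 0`, FROM (LS)-under-finiteness + (CT-𝔖) + the two cited facts.**
Per frame: `𝔖_{v̄}(K, W*)` finite from the dual datum (`hasCharValuationAt_control_identity_endEigenPrimaryTorsion`), conjugate finiteness by `hTr`,
(LS) by `hLSfin`, then -w4 g9's `natCard_endCoinvariants_eq_one_of_frame_of_locSurj` (p668156): `#𝔖_Γ = 1`, `v₂ = 0`.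
[cite: Agboola2007, §5 Prop. 5.1] [cite: JetchevSkinnerWan2017, Lemma 3.3.3 and Prop. 3.3.2] [cite: GreenbergLNM1716, §4 Props. 4.13–4.15] -/
theorem rTop'_of_locSurj_of_finite
    (hPT : ∀ (K : Type) [Field K] [NumberField K], poitouTate_sha_tateDual K) (hcd : fieldCdLE_two_of_numberField)
    (hTr : ∀ (d : ℤ), d ≠ 0 → Squarefree d → d % 4 ≠ 1 →
      ∀ (W : WeierstrassCurve ℚ) [W.IsElliptic] (C : VariableChange ℚ), C • W = cm7.quadraticTwist (d : ℚ) →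
      ∀ (K : Type) [Field K] [NumberField K], IsImaginaryQuadratic K →
      ∀ (v vbar : HeightOneSpectrum (𝓞 K)),
        ((2 : ℕ) : 𝓞 K) ∈ v.asIdeal → ((2 : ℕ) : 𝓞 K) ∈ vbar.asIdeal → vbar ≠ v →
      ∀ (π : (W.baseChange K).endRing), (π : AddMonoid.End (W.baseChange K).geomPoints) * π = π - 2 →
      ∀ (r : ℤ_[2]), r * r = r - 2 →
      Finite (restrictedSelmerBase ↥((W.baseChange K).endEigenPrimaryTorsion 2 π r) 2 vbar) →
      Finite (restrictedSelmerBase ↥((W.baseChange K).endEigenPrimaryTorsion 2 π (1 - r)) 2 v))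
    (hLSfin : ∀ (d : ℤ), d ≠ 0 → Squarefree d → d % 4 ≠ 1 →
      ∀ (W : WeierstrassCurve ℚ) [W.IsElliptic] (C : VariableChange ℚ), C • W = cm7.quadraticTwist (d : ℚ) →
      ∀ (K : Type) [Field K] [NumberField K], IsImaginaryQuadratic K →
      ∀ (v vbar : HeightOneSpectrum (𝓞 K)),
        ((2 : ℕ) : 𝓞 K) ∈ v.asIdeal → ((2 : ℕ) : 𝓞 K) ∈ vbar.asIdeal → vbar ≠ v →
      ∀ (π : (W.baseChange K).endRing), (π : AddMonoid.End (W.baseChange K).geomPoints) * π = π - 2 →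
      ∀ (r : ℤ_[2]), r * r = r - 2 →
      Finite (restrictedSelmerBase ↥((W.baseChange K).endEigenPrimaryTorsion 2 π r) 2 vbar) →
      ∀ (S : Finset (HeightOneSpectrum (𝓞 K))), (∀ w ∈ S, ((2 : ℕ) : 𝓞 K) ∉ w.asIdeal ∨ w = vbar) →
      ∀ τ : (w : HeightOneSpectrum (𝓞 K)) → subgroupH1 (decomp (K := K) w) ↥((W.baseChange K).endEigenPrimaryTorsion 2 π r),
      ∃ g : discreteH1 (absoluteGaloisGroup K) ↥((W.baseChange K).endEigenPrimaryTorsion 2 π r),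
        (∀ w ∈ S, ResKernel.resSubgroup (decomp (K := K) w) ↥((W.baseChange K).endEigenPrimaryTorsion 2 π r) g = τ w) ∧
        (∀ w : HeightOneSpectrum (𝓞 K), w ∉ S → ((2 : ℕ) : 𝓞 K) ∉ w.asIdeal →
          ResKernel.resSubgroup (decomp (K := K) w) ↥((W.baseChange K).endEigenPrimaryTorsion 2 π r) g = 0)) :
    ∃ eΓ : ℤ → ℤ → ℤ, ∀ (d : ℤ), d ≠ 0 → Squarefree d → d % 4 ≠ 1 →
      ∀ (W : WeierstrassCurve ℚ) [W.IsElliptic] [W.IsGloballyMinimal] (C : VariableChange ℚ), C • W = cm7.quadraticTwist (d : ℚ) →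
      ∀ (K : Type) [Field K] [NumberField K], IsImaginaryQuadratic K →
      ∀ (v vbar : HeightOneSpectrum (𝓞 K)),
        ((2 : ℕ) : 𝓞 K) ∈ v.asIdeal → ((2 : ℕ) : 𝓞 K) ∈ vbar.asIdeal → vbar ≠ v →
      ∀ (π : (W.baseChange K).endRing), (π : AddMonoid.End (W.baseChange K).geomPoints) * π = π - 2 →
      ∀ (r : ℤ_[2]), r * r = r - 2 →
        (∀ τ ∈ GreenbergSelmer.inertia v, ∀ x : ↥((W.baseChange K).endEigenPrimaryTorsion 2 π r), τ • x = x ∨ τ • x = -x) →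
      ∀ (κ' : ZpExtension K 2), κ'.IsUnramifiedOutside vbar → ∀ (γ' : absoluteGaloisGroup K), κ'.IsTopGenerator γ' →
      ∀ (D : Agboola2007.RestrictedDualData κ' ↥((W.baseChange K).endEigenPrimaryTorsion 2 π r) vbar γ') (n : ℕ),
        Module.Finite (IwasawaAlgebra 2) D.X → D.HasCharValuationAt n →
        (padicValNat 2 (Nat.card (EndCoinvariants (conjRestricted κ' ↥((W.baseChange K).endEigenPrimaryTorsion 2 π r) vbar γ' - 1))) : ℤ) =
          eΓ (d % 2) ((d / (2 - d % 2)) % 8) := by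
  refine ⟨fun _ _ ↦ 0, ?_⟩
  intro d hd0 hsq hd4 W _ _ C hC K _ _ hK v vbar hv hvbar hne π hrel r hr _ κ' hκ' γ' hγ' D n hDf hDn
  haveI := hDf
  -- bottom finiteness from the dual datum
  have hfinB : Finite (restrictedSelmerBase ↥((W.baseChange K).endEigenPrimaryTorsion 2 π r) 2 vbar) :=
    (hasCharValuationAt_control_identity_endEigenPrimaryTorsion (W.baseChange K) 2 π r κ' hγ' vbar D hDn).2.2.1
  have hfin' := hTr d hd0 hsq hd4 W C hC K hK v vbar hv hvbar hne π hrel r hr hfinB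
  have hLS := hLSfin d hd0 hsq hd4 W C hC K hK v vbar hv hvbar hne π hrel r hr hfinB
  have h1 := natCard_endCoinvariants_eq_one_of_frame_of_locSurj hd0 W C hC hK v vbar hvbar π hrel hr κ' hκ' hγ' D hDf hDn
    (hPT K) hcd hfin' hLS
  rw [h1, padicValNat_one_right]
  simp

end Summit.BirchSwinnertonDyer.BirchSwinnertonDyer.Theorems.PrintCf2.RestrictedSelmerPair

end
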